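import Summits.QuantumFields.BalabanUV.Beta.GAN24.StencilSlotOfShapes
import Summits.QuantumFields.BalabanUV.Beta.GAN24.StencilSlotLamDrift

/-!
# `BalabanUV.Beta.GAN24.StencilSlotCauchyOfShapes` — binder row G-an2-4 / (CONV-C), AFTER the K-slot: the wall's STENCIL Cauchy binder
# `hSall` PROVED AS A FUNCTION OF the K-slot (`UnitDecayK ∧ CauchyDecayK` = `ConvCKWall`) AND THE TWO LOCATED SHAPES of the value-function
# third-jet summand («E3Shape», «E3Drift») — the S-slot END-AS-FUNCTION, Cauchy half (note `HOME/b2b-balaban-gan24-p1/S-SLOT.md` §5–§6)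

NOT IN PRINT; OUR PROOF ATTEMPT (row owner b2b-balaban-gan24-p1, gen 3).  HONEST FRAMING (cell contract, verbatim): «discharging `BetaPertH`
makes Bałaban's UV stability UNCONDITIONAL — a real constructive-QFT result; it is NOT the continuum limit and NOT the Clay problem.»
HONEST DEPENDENCY (verbatim): «continuum YM on T⁴ ⇐ BetaPertH ∧ nine spine estimates (0/9 proved); BetaPertH ⇐ (D1) ∧ (D4) ∧ CAP+tail;
G-an2-4 gates asym, D1 and NE2/3/4.»  [folklore] bookkeeping: the members `≥ 1` telescope summand by summand (`StencilSlotVH`: drift `0`;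
`StencilSlotLamDrift`: drift `CΛd·θ^k`; the third-jet summand: hypothesis «E3Drift»), member `0` = `S0` enters through the UNIFORM bound of
`StencilSlotOfShapes.hS_of_shapes` (a difference of two local families is local, constant `2Cs`), and the rate `θ^{k−1}` of a pair of members
`(k+j, k)`, `k ≥ 1`, is `θ⁻¹·θ^k` (`0 < θ`).  No estimate, no cited fact, no `def`, no `Prop` mirror.  The K-slot data enter as HYPOTHESES
(`UnitDecayK`, `CauchyDecayK` — for `d = 3` theorems of road P1, `GAN24/KSlotAssembly.convCKWall_holds` p204341, not imported: the file stays
generic in `d`); the located shapes «E3Shape»/«E3Drift» are INLINE HYPOTHESES, asserted nowhere.  NOTHING of the wall is discharged; the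
second-order binders `(hW, hWall)`, the window and the identification are untouched; 0 wall binders instantiated.  NOT summit progress.

## What is proved (generic `d`; `Lc` with `NeZero Lc`, `1 ≤ Lc`; units `sfStep`, `smStep d` BY NAME)
* `locStencil_sub` (difference of two local families), `locStencil_unitS_Sstep_sub` — MEMBERS `≥ 1`: for all `k j`,
  `LocStencil (unitS_{k+j+1} (Sstep … (k+j+1)) − unitS_{k+1} (Sstep … (k+1))) ((c₃ + CΛd)·θ^k) (min δ₃ (δ/4))` from `UnitDecayK … C δ`,
  `CauchyDecayK … cK θ δ` (`0 < δ`, `0 ≤ θ`) and «E3Drift» `∀ k j, LocStencil (Ẽ (k+j+1) − Ẽ (k+1)) (c₃·θ^k) δ₃` (`Ẽ n` = the normalised third-jet summand).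
* **`hSall_of_shapes`** — THE WALL'S BINDER SHAPE: from `UnitDecayK`, `CauchyDecayK`, `0 < δ`, `0 < θ`, «E3Shape» (`0 < δ₃`), «E3Drift»:
  `∃ cS δS, 0 < δS ∧ ∀ k j, LocStencil (unitS (sfStep Lc (k+j)) (smStep d Lc (k+j)) (JsBal0Of … (k+j)).S − unitS (sfStep Lc k) (smStep d Lc k) (JsBal0Of … k).S) (cS·θ^k) δS`
  — LITERALLY the hypothesis `hSall` of `HessKerDressedUnitsWall.d1Drift_JsBalOf_iff_of_cauchy_unit` at `sf := sfStep Lc`, `sm := smStep d Lc`;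
  together with `StencilSlotOfShapes.hS_of_shapes`: **(hS, hSall) ⇐ (hK, hKall) ∧ «E3Shape» ∧ «E3Drift»** in the kernel.
-/

noncomputable section

open Literature.MathematicalPhysics.QuantumFieldTheory
open Literature.MathematicalPhysics.QuantumFieldTheory.Balaban1983to89
open Literature.MathematicalPhysics.QuantumFieldTheory.Balaban1983to89.Beta
open B12Sec2to5 (l1 l1_nonneg)
open ExpKernelCalculus (MKer Decays BiLoc VertexFamily₂ Zl Zl_nonneg)
open OneStepResolventKernel (Fib LocStencil)
open OneStepKernelFamily (KInvStep)
open InterLevelTransport (SLam)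
open AveragingHessianKernels (vhS hessFF ell)
open StepJetData (mfNeg)
open BalabanStepJetsSucc (wE wVH wΛ e3Of E2 lamCoeffK Sstep JsBal0Of JsBal0Of_S_zero JsBal0Of_S_succ)
open Summit.QuantumFields.BalabanUV.Beta.HessKerDressedUnits (unitS)
open Summit.QuantumFields.BalabanUV.Beta.GAN24.CombesThomas (sfStep smStep UnitDecayK CauchyDecayK)
open Summit.QuantumFields.BalabanUV.Beta.GAN24.StencilSlotVH (unitS_vhPiece_eq)
open Summit.QuantumFields.BalabanUV.Beta.GAN24.StencilSlotLamDrift (locStencil_unitS_lamPiece_sub)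
open Summit.QuantumFields.BalabanUV.Beta.GAN24.StencilSlotOfShapes (unitS_Sstep_succ_eq locStencil_mono' hS_of_shapes)

namespace Summit.QuantumFields.BalabanUV.Beta.GAN24.StencilSlotCauchyOfShapes

variable {d : ℕ}

/-! ## §1 Two local families differ by a local family -/

/-- [folklore] The difference of two local stencil families (same rate) is local with the sum of the constants. -/
theorem locStencil_sub {S S' : Fin (d + 1) → (Fin (d + 1) → ℤ) → MKer (d + 1) (Fib d)} {C C' δ : ℝ}
    (h : LocStencil S C δ) (h' : LocStencil S' C' δ) : LocStencil (S - S') (C + C') δ := by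
  intro κ u x y a b
  simp only [Pi.sub_apply]
  calc |S κ u x y a b - S' κ u x y a b| ≤ |S κ u x y a b| + |S' κ u x y a b| := abs_sub _ _
    _ ≤ _ := by rw [add_mul]; exact add_le_add (h κ u x y a b) (h' κ u x y a b)

/-! ## §2 Members `≥ 1`: the three summands telescope separately -/

section Members

variable {Lc : ℕ} [NeZero Lc]

/-- [folklore] **DRIFT OF THE NORMALISED STEP STENCILS, MEMBERS `≥ 1`**: for every `k j`, the normalised members `k+j+1` and `k+1` differ by
a local family with constant `(c₃ + CΛd)·θ^k` at rate `min δ₃ (δ/4)` — (V-H) contributes `0` (`StencilSlotVH.unitS_vhPiece_eq`), the Lagrange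
summand `CΛd·θ^k` (`StencilSlotLamDrift.locStencil_unitS_lamPiece_sub`), the third-jet summand `c₃·θ^k` by the hypothesis «E3Drift». -/
theorem locStencil_unitS_Sstep_sub (hLc : 1 ≤ Lc) {C cK θ δ : ℝ} (hK : UnitDecayK d Lc (sfStep Lc) (smStep d Lc) C δ)
    (hKall : CauchyDecayK d Lc (sfStep Lc) (smStep d Lc) cK θ δ) (hδ : 0 < δ) (hθ : 0 ≤ θ) {cE cVH cΛ c₃ δ₃ : ℝ}
    (hE3d : ∀ k j : ℕ, LocStencil (fun κ u =>
        unitS (sfStep Lc (k + j + 1)) (smStep d Lc (k + j + 1))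
            (fun κ u => (cE * wE d Lc (k + j + 1)) • e3Of d Lc cE cVH cΛ (k + j + 1) κ u) κ u -
          unitS (sfStep Lc (k + 1)) (smStep d Lc (k + 1))
            (fun κ u => (cE * wE d Lc (k + 1)) • e3Of d Lc cE cVH cΛ (k + 1) κ u) κ u) (c₃ * θ ^ k) δ₃)
    (hδ₃ : 0 < δ₃) (k j : ℕ) :
    LocStencil (fun κ u => unitS (sfStep Lc (k + j + 1)) (smStep d Lc (k + j + 1)) (Sstep d Lc cE cVH cΛ (k + j + 1)) κ u -
        unitS (sfStep Lc (k + 1)) (smStep d Lc (k + 1)) (Sstep d Lc cE cVH cΛ (k + 1)) κ u)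
      ((c₃ + |cΛ * (Lc : ℝ) ^ (2 * (d + 1))| *
          ((d + 1 : ℕ) * (((Fintype.card (Fib d) : ℝ) * (cK * θ * C + C * cK) * Zl (d + 1) (δ - δ / 2)) *
            (2 * (ell (d + 1) Lc : ℝ) ^ 2 * Real.exp (4 * ((d : ℝ) + 1) * Lc * (δ / 2))) * Zl (d + 1) (δ / 2 / 2)))) * θ ^ k)
      (min δ₃ (δ / 2 / 2)) := by
  -- the three summand drifts at the common rate
  have hm0 : 0 < min δ₃ (δ / 2 / 2) := lt_min hδ₃ (by positivity)
  have hE := locStencil_mono' (hE3d k j) le_rfl (min_le_left δ₃ (δ / 2 / 2))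
  have hL := locStencil_mono' (locStencil_unitS_lamPiece_sub (d := d) hLc hK hKall hδ hθ cΛ k j) le_rfl (min_le_right δ₃ (δ / 2 / 2))
  intro κ u x y a b
  have h1 := hE κ u x y a b
  have h2 := hL κ u x y a b
  simp only [Pi.sub_apply] at h1 h2
  rw [unitS_Sstep_succ_eq, unitS_Sstep_succ_eq]
  simp only [Pi.sub_apply, Pi.add_apply]
  rw [unitS_vhPiece_eq, unitS_vhPiece_eq]
  -- entries: (E₁ + V + Λ₁) − (E₂ + V + Λ₂) = (E₁ − E₂) + (Λ₁ − Λ₂)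
  have halg : ∀ e₁ v l₁ e₂ l₂ : ℝ, e₁ + v + l₁ - (e₂ + v + l₂) = (e₁ - e₂) + (l₁ - l₂) := fun _ _ _ _ _ => by ring
  rw [halg]
  refine (abs_add_le _ _).trans ?_
  refine (add_le_add h1 h2).trans (le_of_eq ?_)
  ring

end Members

/-! ## §3 The wall's binder shape `hSall` for the whole family `JsBal⁰` -/

section Wall

variable {Lc : ℕ} [NeZero Lc]

/-- **THE S-SLOT's CAUCHY HALF AS A FUNCTION OF THE K-SLOT AND THE TWO LOCATED SHAPES** [folklore assembly]: from the wall's own `(hK, hKall)`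
in the adopted units (`UnitDecayK … C δ`, `CauchyDecayK … cK θ δ`, `0 < δ`, `0 < θ`), the uniform shape «E3Shape» (`hE3`, `0 < δ₃`) and the
drift shape «E3Drift» (`hE3d`) of the normalised value-function third-jet summand, for ANY second-order tables `W`:
`∃ cS δS, 0 < δS ∧ ∀ k j, LocStencil (unitS_{k+j} (JsBal0Of … (k+j)).S − unitS_k (JsBal0Of … k).S) (cS·θ^k) δS` — LITERALLY the binder `hSall` of
`HessKerDressedUnitsWall.d1Drift_JsBalOf_iff_of_cauchy_unit` at `sf := sfStep Lc`, `sm := smStep d Lc` (pairs with `k = 0` through the uniform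
bound `2Cs = 2Cs·θ⁰` of `hS_of_shapes`; pairs with `k ≥ 1` through §2 and `θ^{k−1} = θ⁻¹·θ^k`). -/
theorem hSall_of_shapes (hLc : 1 ≤ Lc) {C cK θ δ : ℝ} (hK : UnitDecayK d Lc (sfStep Lc) (smStep d Lc) C δ)
    (hKall : CauchyDecayK d Lc (sfStep Lc) (smStep d Lc) cK θ δ) (hδ : 0 < δ) (hθ : 0 < θ) {cE cVH cΛ C₃ c₃ δ₃ : ℝ}
    (hE3 : ∀ j : ℕ, LocStencil (unitS (sfStep Lc (j + 1)) (smStep d Lc (j + 1))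
      (fun κ u => (cE * wE d Lc (j + 1)) • e3Of d Lc cE cVH cΛ (j + 1) κ u)) C₃ δ₃)
    (hE3d : ∀ k j : ℕ, LocStencil (fun κ u =>
        unitS (sfStep Lc (k + j + 1)) (smStep d Lc (k + j + 1))
            (fun κ u => (cE * wE d Lc (k + j + 1)) • e3Of d Lc cE cVH cΛ (k + j + 1) κ u) κ u -
          unitS (sfStep Lc (k + 1)) (smStep d Lc (k + 1))
            (fun κ u => (cE * wE d Lc (k + 1)) • e3Of d Lc cE cVH cΛ (k + 1) κ u) κ u) (c₃ * θ ^ k) δ₃)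
    (hδ₃ : 0 < δ₃)
    (W : ℕ → Fin (d + 1) → (Fin (d + 1) → ℤ) → Fin (d + 1) → (Fin (d + 1) → ℤ) → MKer (d + 1) (Fib d))
    (Cw δw : ℕ → ℝ) (hδw : ∀ j, 0 < δw j) (hW : ∀ j, VertexFamily₂ (W j) Lc (Cw j) (δw j)) :
    ∃ cS δS : ℝ, 0 < δS ∧ ∀ k j, LocStencil
      (unitS (sfStep Lc (k + j)) (smStep d Lc (k + j)) (JsBal0Of hLc cE cVH cΛ W Cw δw hδw hW (k + j)).S -
        unitS (sfStep Lc k) (smStep d Lc k) (JsBal0Of hLc cE cVH cΛ W Cw δw hδw hW k).S) (cS * θ ^ k) δS := by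
  obtain ⟨Cs, δ₀, hδ₀, hS⟩ := hS_of_shapes (d := d) hLc hK hδ hE3 hδ₃ W Cw δw hδw hW
  -- the members-≥1 drift constant
  set Cd : ℝ := c₃ + |cΛ * (Lc : ℝ) ^ (2 * (d + 1))| *
      ((d + 1 : ℕ) * (((Fintype.card (Fib d) : ℝ) * (cK * θ * C + C * cK) * Zl (d + 1) (δ - δ / 2)) *
        (2 * (ell (d + 1) Lc : ℝ) ^ 2 * Real.exp (4 * ((d : ℝ) + 1) * Lc * (δ / 2))) * Zl (d + 1) (δ / 2 / 2))) with hCd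
  have hdrift : ∀ k j, LocStencil (fun κ u => unitS (sfStep Lc (k + j + 1)) (smStep d Lc (k + j + 1)) (Sstep d Lc cE cVH cΛ (k + j + 1)) κ u -
      unitS (sfStep Lc (k + 1)) (smStep d Lc (k + 1)) (Sstep d Lc cE cVH cΛ (k + 1)) κ u) (Cd * θ ^ k) (min δ₃ (δ / 2 / 2)) :=
    fun k j => locStencil_unitS_Sstep_sub hLc hK hKall hδ hθ.le hE3d hδ₃ k j
  have hCs : 0 ≤ Cs := ((hS 0) 0 0).nonneg (Sum.inl 0)
  have hCd0 : 0 ≤ Cd := by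
    have h := ((hdrift 0 0) 0 0).nonneg (Sum.inl 0)
    simpa using h
  have hm0 : 0 < min δ₃ (δ / 2 / 2) := lt_min hδ₃ (by positivity)
  set δS : ℝ := min δ₀ (min δ₃ (δ / 2 / 2)) with hδS
  have hδS0 : 0 < δS := lt_min hδ₀ hm0
  refine ⟨max (Cs + Cs) (Cd * θ⁻¹), δS, hδS0, fun k j => ?_⟩
  cases k with
  | zero =>
      -- k = 0: uniform bound on both members, θ^0 = 1
      have h := locStencil_sub (hS (0 + j)) (hS 0)
      rw [pow_zero, mul_one]
      exact locStencil_mono' h (le_max_left _ _) (min_le_left _ _)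
  | succ k =>
      -- k+1 ≥ 1: members (k+j+1, k+1), drift Cd θ^k = (Cd θ⁻¹) θ^(k+1)
      rw [show k + 1 + j = k + j + 1 by omega, JsBal0Of_S_succ, JsBal0Of_S_succ]
      have h := hdrift k j
      have hθk : Cd * θ ^ k ≤ max (Cs + Cs) (Cd * θ⁻¹) * θ ^ (k + 1) := by
        calc Cd * θ ^ k = (Cd * θ⁻¹) * θ ^ (k + 1) := by rw [pow_succ]; field_simp
          _ ≤ max (Cs + Cs) (Cd * θ⁻¹) * θ ^ (k + 1) :=
            mul_le_mul_of_nonneg_right (le_max_right _ _) (pow_nonneg hθ.le _)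
      exact locStencil_mono' h hθk (min_le_right _ _)

end Wall

end Summit.QuantumFields.BalabanUV.Beta.GAN24.StencilSlotCauchyOfShapes

end
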